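import Literature.Geometry.Symplectic.GromovR4StdModel
import Literature.Geometry.Manifold.OpenSubmanifoldMFDeriv

/-!
# Chart transport for the Liouville collar: the inverse chart as a map into `Σ ∖ p`

Helper file of stub `stub_liouvilleCollar` (line `kaehler-jacket`, crux stmt-SmoothPoincare4-7823).
The collar lemma (Geiges 2008, Lemma 5.2.4) is proved in the chart `e = extChartAt q` of the inner
sphere; this file is the bookkeeping that moves data between the punctured manifold `M ∖ p` and
`ℝ⁴`.  For a section `σ : ℝ⁴ → M ∖ p` of the chart over the ball `B = ball (e q) μ'`
(`(σ y).1 = e.symm y` there; the closed ball lies in the chart target and misses `p`):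

* `σ` is `C^∞` on `B`, `e (σ y) = y`, `σ (e x) = x`, and the differentials
  `L_x = d(e ∘ val)_x`, `D_y = dσ_y` are mutually inverse (`chartSection_*`);
* a map `Φ : M ∖ p → ℝ⁴` smooth at `σ y` reads `Φ ∘ σ`, smooth at `y`, with
  `D(Φ ∘ σ)_y = dΦ ∘ D_y` and `dΦ_{σ y} = D(Φ ∘ σ)_y ∘ L` (`chartSection_comp`);
* a map `Ψ̃ : ℝ⁴ → ℝ⁴` smooth at `e x` gives `Ψ̃ ∘ e ∘ val` smooth at `x` with
  `d(Ψ̃ ∘ e)_x = DΨ̃ ∘ L_x` (`contMDiffAt_comp_extChartAt`);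
packaged for the carrier of a homotopy `4`-sphere as `helper_kjChartTransport`.

## References

* J. M. Lee, *Introduction to Smooth Manifolds*, 2nd ed. (2013), Prop. 3.9, Example 1.26
  (open submanifolds), Prop. 3.6 (chain rule). [LeeSmoothManifolds2013]
-/

noncomputable section

set_option linter.dupNamespace false

open scoped Manifold ContDiff Topology
open Set Function Metric
open Literature.Geometry.Symplectic (punctured)
open Literature.Topology.FourManifolds (HomotopySphere)

namespace Summit.SmoothPoincare4.SmoothPoincare4.Theorems.Target.KaehlerJacket

/-- Model space `ℝ⁴ = ℂ²`. -/
local notation "E4" => EuclideanSpace ℝ (Fin 4)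

section General

variable {M : Type*} [TopologicalSpace M] [T2Space M] [ChartedSpace E4 M]
  [IsManifold (𝓡 4) ∞ M] {p q : M} {μ' : ℝ} {σ : E4 → punctured p}

/-- `e ∘ val : M ∖ p → ℝ⁴` is smooth on the chart source. [folklore] -/
theorem contMDiffAt_extChartAt_val (q : M) {x : punctured p}
    (hx : x.1 ∈ (chartAt E4 q).source) :
    ContMDiffAt (𝓡 4) 𝓘(ℝ, E4) ∞ (fun z : punctured p => extChartAt (𝓡 4) q z.1) x := by
  have hE : ContMDiffOn (𝓡 4) 𝓘(ℝ, E4) ∞ (fun z : punctured p => extChartAt (𝓡 4) q z.1)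
      {z : punctured p | z.1 ∈ (chartAt E4 q).source} :=
    (contMDiffOn_extChartAt (I := 𝓡 4) (x := q) (n := ∞)).comp
      (contMDiff_subtype_val (I := 𝓡 4) (n := ∞) (U := punctured p)).contMDiffOn (fun z hz => hz)
  exact (hE x hx).contMDiffAt
    ((continuous_subtype_val.isOpen_preimage _ (chartAt E4 q).open_source).mem_nhds hx)

/-- A map `Ψ̃ : ℝ⁴ → ℝ⁴` smooth at `e x` composed with the chart: smooth at `x`, with
`d(Ψ̃ ∘ e ∘ val)_x = DΨ̃_{e x} ∘ d(e ∘ val)_x`. [folklore] -/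
theorem contMDiffAt_comp_extChartAt (q : M) {Ψt : E4 → E4} {x : punctured p}
    (hx : x.1 ∈ (chartAt E4 q).source) (hΨ : ContDiffAt ℝ ∞ Ψt (extChartAt (𝓡 4) q x.1)) :
    ContMDiffAt (𝓡 4) 𝓘(ℝ, E4) ∞ (fun z : punctured p => Ψt (extChartAt (𝓡 4) q z.1)) x ∧
    mfderiv (𝓡 4) 𝓘(ℝ, E4) (fun z : punctured p => Ψt (extChartAt (𝓡 4) q z.1)) x =
      (fderiv ℝ Ψt (extChartAt (𝓡 4) q x.1)).comp
        (mfderiv (𝓡 4) 𝓘(ℝ, E4) (fun z : punctured p => extChartAt (𝓡 4) q z.1) x) := by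
  have he := contMDiffAt_extChartAt_val q hx
  have hΨ' : ContMDiffAt 𝓘(ℝ, E4) 𝓘(ℝ, E4) ∞ Ψt (extChartAt (𝓡 4) q x.1) :=
    contMDiffAt_iff_contDiffAt.2 hΨ
  refine ⟨hΨ'.comp x he, ?_⟩
  rw [← mfderiv_eq_fderiv]
  exact mfderiv_comp x (hΨ'.mdifferentiableAt (by simp)) (he.mdifferentiableAt (by simp))

/-- **The chart section `σ`**: `(σ y).1 = e.symm y` on the ball `B`; then `σ` is smooth on `B`,
lands in the chart source, `e (σ y) = y`, and `σ (e x) = x`. [folklore] -/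
theorem chartSection_basic
    (hball : closedBall (extChartAt (𝓡 4) q q) μ' ⊆ (extChartAt (𝓡 4) q).target)
    (hσ : ∀ y ∈ ball (extChartAt (𝓡 4) q q) μ', (σ y).1 = (extChartAt (𝓡 4) q).symm y)
    {y : E4} (hy : y ∈ ball (extChartAt (𝓡 4) q q) μ') :
    ContMDiffAt 𝓘(ℝ, E4) (𝓡 4) ∞ σ y ∧ (σ y).1 ∈ (chartAt E4 q).source ∧
      extChartAt (𝓡 4) q (σ y).1 = y := by
  set e := extChartAt (𝓡 4) q with he
  have hyt : y ∈ e.target := hball (ball_subset_closedBall hy)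
  refine ⟨?_, ?_, ?_⟩
  · rw [← ContMDiffAt.subtypeVal_comp_iff]
    have hev : Subtype.val ∘ σ =ᶠ[𝓝 y] e.symm :=
      Filter.eventuallyEq_of_mem (isOpen_ball.mem_nhds hy) fun y' hy' => hσ y' hy'
    exact ((contMDiffOn_extChartAt_symm (I := 𝓡 4) (n := ∞) q).contMDiffAt
      ((isOpen_extChartAt_target (I := 𝓡 4) q).mem_nhds hyt)).congr_of_eventuallyEq hev
  · rw [hσ y hy, ← extChartAt_source (I := 𝓡 4)]
    exact e.map_target hyt
  · rw [hσ y hy]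
    exact e.right_inv hyt

omit [IsManifold (𝓡 4) ∞ M] in
/-- `σ (e x) = x` for `x` in the chart source with `e x ∈ B`. [folklore] -/
theorem chartSection_apply_extChartAt
    (hσ : ∀ y ∈ ball (extChartAt (𝓡 4) q q) μ', (σ y).1 = (extChartAt (𝓡 4) q).symm y)
    {x : punctured p} (hx : x.1 ∈ (chartAt E4 q).source)
    (hxb : extChartAt (𝓡 4) q x.1 ∈ ball (extChartAt (𝓡 4) q q) μ') :
    σ (extChartAt (𝓡 4) q x.1) = x := by
  apply Subtype.ext
  rw [hσ _ hxb]
  exact (extChartAt (𝓡 4) q).left_inv (by rwa [extChartAt_source])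

/-- **The differentials of `σ` and `e ∘ val` are mutually inverse.** [folklore] -/
theorem chartSection_mfderiv
    (hball : closedBall (extChartAt (𝓡 4) q q) μ' ⊆ (extChartAt (𝓡 4) q).target)
    (hσ : ∀ y ∈ ball (extChartAt (𝓡 4) q q) μ', (σ y).1 = (extChartAt (𝓡 4) q).symm y)
    {y : E4} (hy : y ∈ ball (extChartAt (𝓡 4) q q) μ') :
    (mfderiv (𝓡 4) 𝓘(ℝ, E4) (fun z : punctured p => extChartAt (𝓡 4) q z.1) (σ y)).comp
        (mfderiv 𝓘(ℝ, E4) (𝓡 4) σ y) = ContinuousLinearMap.id ℝ E4 ∧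
    (mfderiv 𝓘(ℝ, E4) (𝓡 4) σ y).comp
        (mfderiv (𝓡 4) 𝓘(ℝ, E4) (fun z : punctured p => extChartAt (𝓡 4) q z.1) (σ y)) =
      ContinuousLinearMap.id ℝ (TangentSpace (𝓡 4) (σ y)) := by
  set e := extChartAt (𝓡 4) q with he_def
  obtain ⟨hσs, hsrc, heσ⟩ := chartSection_basic hball hσ hy
  have hev := contMDiffAt_extChartAt_val (p := p) q hsrc
  have hσd : MDifferentiableAt 𝓘(ℝ, E4) (𝓡 4) σ y := hσs.mdifferentiableAt (by simp)
  have hed : MDifferentiableAt (𝓡 4) 𝓘(ℝ, E4) (fun z : punctured p => e z.1) (σ y) :=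
    hev.mdifferentiableAt (by simp)
  constructor
  · -- `(e ∘ val) ∘ σ = id` near `y`
    have h1 : ((fun z : punctured p => e z.1) ∘ σ) =ᶠ[𝓝 y] id :=
      Filter.eventuallyEq_of_mem (isOpen_ball.mem_nhds hy) fun y' hy' =>
        (chartSection_basic hball hσ hy').2.2
    rw [← mfderiv_comp y hed hσd, h1.mfderiv_eq, mfderiv_id]
    rfl
  · -- `σ ∘ (e ∘ val) = id` near `σ y`
    have hO : IsOpen {z : punctured p | z.1 ∈ (chartAt E4 q).source ∧ e z.1 ∈ ball (e q) μ'} := by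
      have h : IsOpen (e.source ∩ e ⁻¹' ball (e q) μ') :=
        (continuousOn_extChartAt (I := 𝓡 4) q).isOpen_inter_preimage
          (isOpen_extChartAt_source (I := 𝓡 4) q) isOpen_ball
      rw [he_def, extChartAt_source] at h
      exact h.preimage continuous_subtype_val
    have h1 : (σ ∘ fun z : punctured p => e z.1) =ᶠ[𝓝 (σ y)] id := by
      refine Filter.eventuallyEq_of_mem (hO.mem_nhds ⟨hsrc, by rw [heσ]; exact hy⟩) ?_
      intro z hz
      exact chartSection_apply_extChartAt hσ hz.1 hz.2
    have hσd' : MDifferentiableAt 𝓘(ℝ, E4) (𝓡 4) σ (e (σ y).1) := by rw [heσ]; exact hσd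
    have h2 := mfderiv_comp (σ y) hσd' hed
    rw [h1.mfderiv_eq, mfderiv_id] at h2
    rw [heσ] at h2
    exact h2.symm

/-- **A map `Φ : M ∖ p → ℝ⁴` read through `σ`.** If `Φ` is smooth at `σ y` (`y ∈ B`), then
`Φ ∘ σ` is smooth at `y`, `D(Φ ∘ σ)_y = dΦ_{σ y} ∘ dσ_y`, and `dΦ_{σ y} = D(Φ ∘ σ)_y ∘ d(e ∘ val)`.
[folklore] -/
theorem chartSection_comp
    (hball : closedBall (extChartAt (𝓡 4) q q) μ' ⊆ (extChartAt (𝓡 4) q).target)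
    (hσ : ∀ y ∈ ball (extChartAt (𝓡 4) q q) μ', (σ y).1 = (extChartAt (𝓡 4) q).symm y)
    {Φ : punctured p → E4} {y : E4} (hy : y ∈ ball (extChartAt (𝓡 4) q q) μ')
    (hΦ : ContMDiffAt (𝓡 4) 𝓘(ℝ, E4) ∞ Φ (σ y)) :
    ContDiffAt ℝ ∞ (fun y => Φ (σ y)) y ∧
    fderiv ℝ (fun y => Φ (σ y)) y =
      (mfderiv (𝓡 4) 𝓘(ℝ, E4) Φ (σ y)).comp (mfderiv 𝓘(ℝ, E4) (𝓡 4) σ y) ∧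
    mfderiv (𝓡 4) 𝓘(ℝ, E4) Φ (σ y) = (fderiv ℝ (fun y => Φ (σ y)) y).comp
      (mfderiv (𝓡 4) 𝓘(ℝ, E4) (fun z : punctured p => extChartAt (𝓡 4) q z.1) (σ y)) := by
  obtain ⟨hσs, -, -⟩ := chartSection_basic hball hσ hy
  have hcomp : ContMDiffAt 𝓘(ℝ, E4) 𝓘(ℝ, E4) ∞ (Φ ∘ σ) y := hΦ.comp y hσs
  have hfd : fderiv ℝ (fun y => Φ (σ y)) y =
      (mfderiv (𝓡 4) 𝓘(ℝ, E4) Φ (σ y)).comp (mfderiv 𝓘(ℝ, E4) (𝓡 4) σ y) := by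
    rw [← mfderiv_eq_fderiv]
    exact mfderiv_comp y (hΦ.mdifferentiableAt (by simp)) (hσs.mdifferentiableAt (by simp))
  refine ⟨contMDiffAt_iff_contDiffAt.1 hcomp, hfd, ?_⟩
  refine ContinuousLinearMap.ext fun v => ?_
  have hDL := (chartSection_mfderiv hball hσ hy).2
  have h2 : mfderiv 𝓘(ℝ, E4) (𝓡 4) σ y
      (mfderiv (𝓡 4) 𝓘(ℝ, E4) (fun z : punctured p => extChartAt (𝓡 4) q z.1) (σ y) v) = v :=
    congrArg (fun T : TangentSpace (𝓡 4) (σ y) →L[ℝ] TangentSpace (𝓡 4) (σ y) => T v) hDL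
  show mfderiv (𝓡 4) 𝓘(ℝ, E4) Φ (σ y) v = fderiv ℝ (fun y => Φ (σ y)) y
    (mfderiv (𝓡 4) 𝓘(ℝ, E4) (fun z : punctured p => extChartAt (𝓡 4) q z.1) (σ y) v)
  rw [hfd]
  show _ = mfderiv (𝓡 4) 𝓘(ℝ, E4) Φ (σ y) (mfderiv 𝓘(ℝ, E4) (𝓡 4) σ y
    (mfderiv (𝓡 4) 𝓘(ℝ, E4) (fun z : punctured p => extChartAt (𝓡 4) q z.1) (σ y) v))
  rw [h2]

/-- If `F = Φ ∘ σ ∘ e ∘ val` near `x` … more precisely: for `x` in the chart source with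
`e x ∈ B`, a map `Φ` on `M ∖ p` agrees near `x` with `(Φ ∘ σ) ∘ (e ∘ val)`, so
`dΦ_x = D(Φ ∘ σ)_{e x} ∘ d(e ∘ val)_x` whenever `Φ` is smooth at `x`. [folklore] -/
theorem chartSection_mfderiv_eq
    (hball : closedBall (extChartAt (𝓡 4) q q) μ' ⊆ (extChartAt (𝓡 4) q).target)
    (hσ : ∀ y ∈ ball (extChartAt (𝓡 4) q q) μ', (σ y).1 = (extChartAt (𝓡 4) q).symm y)
    {Φ : punctured p → E4} {x : punctured p} (hx : x.1 ∈ (chartAt E4 q).source)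
    (hxb : extChartAt (𝓡 4) q x.1 ∈ ball (extChartAt (𝓡 4) q q) μ')
    (hΦ : ContMDiffAt (𝓡 4) 𝓘(ℝ, E4) ∞ Φ x) :
    ContDiffAt ℝ ∞ (fun y => Φ (σ y)) (extChartAt (𝓡 4) q x.1) ∧
    mfderiv (𝓡 4) 𝓘(ℝ, E4) Φ x = (fderiv ℝ (fun y => Φ (σ y)) (extChartAt (𝓡 4) q x.1)).comp
      (mfderiv (𝓡 4) 𝓘(ℝ, E4) (fun z : punctured p => extChartAt (𝓡 4) q z.1) x) := by
  have hσx : σ (extChartAt (𝓡 4) q x.1) = x := chartSection_apply_extChartAt hσ hx hxb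
  have hΦ' : ContMDiffAt (𝓡 4) 𝓘(ℝ, E4) ∞ Φ (σ (extChartAt (𝓡 4) q x.1)) := by rwa [hσx]
  obtain ⟨h1, -, h3⟩ := chartSection_comp hball hσ hxb hΦ'
  rw [hσx] at h3
  exact ⟨h1, h3⟩

end General

/-- **Chart transport for the Liouville collar** (`helper_kjChartTransport`): the bookkeeping of
this file for the carrier of a homotopy `4`-sphere — smoothness of a chart section `σ` over the
ball `B = ball (e q) μ'`, the round trips `e (σ y) = y`, `σ (e x) = x`, the mutually inverse
differentials `d(e ∘ val) ∘ dσ = id`, `dσ ∘ d(e ∘ val) = id`, and the chain rules for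
`Φ ∘ σ` (`Φ : Σ ∖ p → ℝ⁴`) and `Ψ̃ ∘ e` (`Ψ̃ : ℝ⁴ → ℝ⁴`). [folklore] -/
theorem helper_kjChartTransport :
    ∀ (S : HomotopySphere 4) (p q : S.carrier) (μ' : ℝ) (σ : E4 → punctured p),
      Metric.closedBall (extChartAt (𝓡 4) q q) μ' ⊆ (extChartAt (𝓡 4) q).target →
      (∀ y ∈ Metric.ball (extChartAt (𝓡 4) q q) μ', (σ y).1 = (extChartAt (𝓡 4) q).symm y) →
      (∀ y ∈ Metric.ball (extChartAt (𝓡 4) q q) μ',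
        ContMDiffAt 𝓘(ℝ, E4) (𝓡 4) ∞ σ y ∧ (σ y).1 ∈ (chartAt E4 q).source ∧
        extChartAt (𝓡 4) q (σ y).1 = y ∧
        (mfderiv (𝓡 4) 𝓘(ℝ, E4) (fun z : punctured p => extChartAt (𝓡 4) q z.1) (σ y)).comp
            (mfderiv 𝓘(ℝ, E4) (𝓡 4) σ y) = ContinuousLinearMap.id ℝ E4 ∧
        (mfderiv 𝓘(ℝ, E4) (𝓡 4) σ y).comp
            (mfderiv (𝓡 4) 𝓘(ℝ, E4) (fun z : punctured p => extChartAt (𝓡 4) q z.1) (σ y)) =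
          ContinuousLinearMap.id ℝ (TangentSpace (𝓡 4) (σ y)) ∧
        ∀ Φ : punctured p → E4, ContMDiffAt (𝓡 4) 𝓘(ℝ, E4) ∞ Φ (σ y) →
          ContDiffAt ℝ ∞ (fun y => Φ (σ y)) y ∧
          fderiv ℝ (fun y => Φ (σ y)) y =
            (mfderiv (𝓡 4) 𝓘(ℝ, E4) Φ (σ y)).comp (mfderiv 𝓘(ℝ, E4) (𝓡 4) σ y)) ∧
      (∀ x : punctured p, x.1 ∈ (chartAt E4 q).source →
        extChartAt (𝓡 4) q x.1 ∈ Metric.ball (extChartAt (𝓡 4) q q) μ' →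
        σ (extChartAt (𝓡 4) q x.1) = x ∧
        ContMDiffAt (𝓡 4) 𝓘(ℝ, E4) ∞ (fun z : punctured p => extChartAt (𝓡 4) q z.1) x ∧
        (∀ Φ : punctured p → E4, ContMDiffAt (𝓡 4) 𝓘(ℝ, E4) ∞ Φ x →
          ContDiffAt ℝ ∞ (fun y => Φ (σ y)) (extChartAt (𝓡 4) q x.1) ∧
          mfderiv (𝓡 4) 𝓘(ℝ, E4) Φ x =
            (fderiv ℝ (fun y => Φ (σ y)) (extChartAt (𝓡 4) q x.1)).comp
              (mfderiv (𝓡 4) 𝓘(ℝ, E4) (fun z : punctured p => extChartAt (𝓡 4) q z.1) x)) ∧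
        (∀ Ψt : E4 → E4, ContDiffAt ℝ ∞ Ψt (extChartAt (𝓡 4) q x.1) →
          ContMDiffAt (𝓡 4) 𝓘(ℝ, E4) ∞ (fun z : punctured p => Ψt (extChartAt (𝓡 4) q z.1)) x ∧
          mfderiv (𝓡 4) 𝓘(ℝ, E4) (fun z : punctured p => Ψt (extChartAt (𝓡 4) q z.1)) x =
            (fderiv ℝ Ψt (extChartAt (𝓡 4) q x.1)).comp
              (mfderiv (𝓡 4) 𝓘(ℝ, E4) (fun z : punctured p => extChartAt (𝓡 4) q z.1) x))) := by
  intro S p q μ' σ hball hσ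
  refine ⟨fun y hy => ?_, fun x hx hxb => ?_⟩
  · obtain ⟨h1, h2, h3⟩ := chartSection_basic hball hσ hy
    obtain ⟨h4, h5⟩ := chartSection_mfderiv hball hσ hy
    exact ⟨h1, h2, h3, h4, h5, fun Φ hΦ =>
      ⟨(chartSection_comp hball hσ hy hΦ).1, (chartSection_comp hball hσ hy hΦ).2.1⟩⟩
  · exact ⟨chartSection_apply_extChartAt hσ hx hxb, contMDiffAt_extChartAt_val q hx,
      fun Φ hΦ => chartSection_mfderiv_eq hball hσ hx hxb hΦ,
      fun Ψt hΨ => contMDiffAt_comp_extChartAt q hx hΨ⟩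

end Summit.SmoothPoincare4.SmoothPoincare4.Theorems.Target.KaehlerJacket

end
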